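import Mathlib

/-!
# The split weight on the block cube is symmetric and log-supermodular (blind cell PercRepro2,
p3 g28, 2026-08-28; `proofs/P3-PENDANT.md` §2 (iii))

The weight of CLASS C4 of the single-`d` statement counts the legal pocket colourings for a
given vector of block sides `x ⊆ ι`; it depends on the sides only through the status of `d`:
`a` when the `S`-blocks (the blocks joined to `d`) are all on one side (`S ⊆ x` or
`Disjoint S x`: `d` in one world) and `b ≤ a` when they are split (`d` doubly reached, the
stronger legality).  The weight `x ↦ if S ⊆ x ∨ Disjoint S x then a else b` is invariant
under the complement (`splitWeight_compl`) and log-supermodular (`splitWeight_mul_le`): the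
pair `(x ⊓ y, x ⊔ y)` never has more split members than `(x, y)`.  Together with
`M9WeightedHarris` this is the Harris step of C4.  No definitions.  Own work; std axioms.
-/

namespace Summit.Ventures.PercRepro2

namespace M9Reduce

open Finset

variable {ι : Type*} [DecidableEq ι]

/-- The complement of an unsplit vector is unsplit. -/
lemma unsplit_compl [Fintype ι] {S x : Finset ι} (h : S ⊆ x ∨ Disjoint S x) :
    S ⊆ xᶜ ∨ Disjoint S xᶜ := by
  rcases h with h | h
  · refine Or.inr (Finset.disjoint_left.2 fun a ha hc => ?_)
    exact (Finset.mem_compl.1 hc) (h ha)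
  · refine Or.inl fun a ha => Finset.mem_compl.2 fun hx => ?_
    exact Finset.disjoint_left.1 h ha hx

/-- The split weight is invariant under the complement. -/
lemma splitWeight_compl [Fintype ι] (S : Finset ι) (a b : ℤ) (x : Finset ι) :
    (if S ⊆ xᶜ ∨ Disjoint S xᶜ then a else b) = (if S ⊆ x ∨ Disjoint S x then a else b) := by
  by_cases h : S ⊆ x ∨ Disjoint S x
  · rw [if_pos (unsplit_compl h), if_pos h]
  · have h' : ¬ (S ⊆ xᶜ ∨ Disjoint S xᶜ) := fun h' => h (by simpa using unsplit_compl h')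
    rw [if_neg h', if_neg h]

/-- Two unsplit vectors have an unsplit intersection and an unsplit union. -/
lemma unsplit_inter_union {S x y : Finset ι} (hx : S ⊆ x ∨ Disjoint S x)
    (hy : S ⊆ y ∨ Disjoint S y) :
    (S ⊆ x ∩ y ∨ Disjoint S (x ∩ y)) ∧ (S ⊆ x ∪ y ∨ Disjoint S (x ∪ y)) := by
  rcases hx with hx | hx <;> rcases hy with hy | hy
  · exact ⟨Or.inl (Finset.subset_inter hx hy), Or.inl (hx.trans Finset.subset_union_left)⟩
  · refine ⟨Or.inr ?_, Or.inl (hx.trans Finset.subset_union_left)⟩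
    exact Finset.disjoint_of_subset_right Finset.inter_subset_right hy
  · refine ⟨Or.inr ?_, Or.inl (hy.trans Finset.subset_union_right)⟩
    exact Finset.disjoint_of_subset_right Finset.inter_subset_left hx
  · exact ⟨Or.inr (Finset.disjoint_of_subset_right Finset.inter_subset_left hx),
      Or.inr (Finset.disjoint_union_right.2 ⟨hx, hy⟩)⟩

/-- If `y` is unsplit then `x ∩ y` or `x ∪ y` is unsplit. -/
lemma unsplit_inter_or_union {S x y : Finset ι} (hy : S ⊆ y ∨ Disjoint S y) :
    (S ⊆ x ∩ y ∨ Disjoint S (x ∩ y)) ∨ (S ⊆ x ∪ y ∨ Disjoint S (x ∪ y)) := by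
  rcases hy with hy | hy
  · exact Or.inr (Or.inl (hy.trans Finset.subset_union_right))
  · exact Or.inl (Or.inr (Finset.disjoint_of_subset_right Finset.inter_subset_right hy))

/-- **Log-supermodularity of the split weight** for `0 ≤ b ≤ a`. -/
theorem splitWeight_mul_le (S : Finset ι) {a b : ℤ} (hb : 0 ≤ b) (hab : b ≤ a)
    (x y : Finset ι) :
    (if S ⊆ x ∨ Disjoint S x then a else b) * (if S ⊆ y ∨ Disjoint S y then a else b) ≤
      (if S ⊆ x ⊓ y ∨ Disjoint S (x ⊓ y) then a else b) *
        (if S ⊆ x ⊔ y ∨ Disjoint S (x ⊔ y) then a else b) := by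
  have ha : 0 ≤ a := hb.trans hab
  have hge : ∀ z : Finset ι, b ≤ (if S ⊆ z ∨ Disjoint S z then a else b) := fun z => by
    split_ifs <;> linarith
  have hnn : ∀ z : Finset ι, 0 ≤ (if S ⊆ z ∨ Disjoint S z then a else b) :=
    fun z => hb.trans (hge z)
  simp only [Finset.inf_eq_inter, Finset.sup_eq_union]
  by_cases hx : S ⊆ x ∨ Disjoint S x <;> by_cases hy : S ⊆ y ∨ Disjoint S y
  · -- both unsplit: both results unsplit
    obtain ⟨h1, h2⟩ := unsplit_inter_union hx hy
    rw [if_pos hx, if_pos hy, if_pos h1, if_pos h2]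
  · -- `x` unsplit, `y` split: one result is `a`, the other is at least `b`
    rw [if_pos hx, if_neg hy]
    rcases unsplit_inter_or_union (x := y) hx with h | h
    · rw [Finset.inter_comm] at h
      rw [if_pos h]
      exact mul_le_mul_of_nonneg_left (hge _) ha
    · rw [Finset.union_comm] at h
      rw [if_pos h, mul_comm a b]
      exact mul_le_mul_of_nonneg_right (hge _) ha
  · -- `x` split, `y` unsplit
    rw [if_neg hx, if_pos hy]
    rcases unsplit_inter_or_union (x := x) hy with h | h
    · rw [if_pos h, mul_comm b a]
      exact mul_le_mul_of_nonneg_left (hge _) ha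
    · rw [if_pos h]
      exact mul_le_mul_of_nonneg_right (hge _) ha
  · -- both split: the left side is `b * b`
    rw [if_neg hx, if_neg hy]
    exact mul_le_mul (hge _) (hge _) hb (hnn _)

end M9Reduce

end Summit.Ventures.PercRepro2
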